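import Summits.ABC.ABC.Theses.IneffectiveSubspace

/-!
# `UniformSadicTowerFour` (stmt-ABC-14937), line `flat-steep-split`: flat triples have at least eight prime factors

Structural fact about the FLAT child (`stub_flatFace` / FLAT-QUARTER: abc with `rad₄` on triples all of whose
prime-power blocks are `< c^{1/4}`): such a triple has `ω(abc) ≥ 8` (`flat_eight_le_card_primeFactors`).
Reason: `abc = ∏ blocks < (c^{1/4})^{ω(abc)}` while `abc ≥ c · (c − 1) ≥ c^{7/4}` (`ab ≥ c − 1`, and a flat
triple has `c > 16` because some block is `≥ 2`).  So the flat regime is disjoint from every small-`ω` cell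
of the crux (`ω(abc) ≤ 2` landed, `ω = 3` Wieferich-blocked): it starts at `abc ≥ 2·3·5·7·11·13·17·19`.
-/

-- `Summit.<Summit>.<Problem>` is the mandated summit-side namespace (CONVENTIONS §2); for the
-- single-conjunct summit `ABC` the two coincide, so the duplicate `ABC.ABC` is deliberate.
set_option linter.dupNamespace false

namespace Summit.ABC.ABC.Theorems.UniformSadicTowerFour.FlatFace

open Literature.NumberTheory.DiophantineGeometry (IsABCTriple)
open scoped BigOperators

/-- `ab ≥ c − 1`, hence `abc ≥ c (c − 1)`, for an abc triple. [folklore] -/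
theorem mul_pred_le_abc {a b c : ℕ} (h : IsABCTriple a b c) : c * (c - 1) ≤ a * b * c := by
  obtain ⟨ha, hb, hsum, _⟩ := h
  have hab : c - 1 ≤ a * b := by
    rcases Nat.lt_or_ge a 2 with ha2 | ha2
    · have : a = 1 := by omega
      subst this; omega
    rcases Nat.lt_or_ge b 2 with hb2 | hb2
    · have : b = 1 := by omega
      subst this; omega
    have := Nat.add_le_mul ha2 hb2
    omega
  calc c * (c - 1) ≤ c * (a * b) := Nat.mul_le_mul_left c hab
    _ = a * b * c := by ring

/-- **A flat triple has at least eight prime factors**: if every block satisfies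
`p^{v_p(abc)} < c^{1/4}` then `8 ≤ ω(abc)`. [folklore] -/
theorem flat_eight_le_card_primeFactors {a b c : ℕ} (h : IsABCTriple a b c)
    (hflat : ∀ p ∈ (a * b * c).primeFactors,
      ((p ^ (a * b * c).factorization p : ℕ) : ℝ) < (c : ℝ) ^ (1 / 4 : ℝ)) :
    8 ≤ (a * b * c).primeFactors.card := by
  have h' := h
  obtain ⟨ha, hb, hsum, hcop⟩ := h
  have hc : 0 < c := by omega
  set N := a * b * c with hN
  have hN0 : N ≠ 0 := Nat.mul_ne_zero (Nat.mul_ne_zero ha.ne' hb.ne') hc.ne'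
  have hN2 : 2 ≤ N := by
    have : c ≤ N := Nat.le_mul_of_pos_left c (Nat.mul_pos ha hb)
    omega
  -- `N = ∏ blocks`
  have hprod : ∏ p ∈ N.primeFactors, p ^ N.factorization p = N := by
    have := Nat.prod_factorization_pow_eq_self hN0
    rwa [Finsupp.prod, Nat.support_factorization] at this
  -- some prime divides `N`, so the prime factors are non-empty and `c^{1/4} > 2`
  have hne : N.primeFactors.Nonempty := by
    rw [Nat.nonempty_primeFactors]; exact hN2
  obtain ⟨p₀, hp₀⟩ := hne
  have hp₀P : p₀.Prime := Nat.prime_of_mem_primeFactors hp₀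
  have hv₀ : 0 < N.factorization p₀ :=
    hp₀P.factorization_pos_of_dvd hN0 (Nat.dvd_of_mem_primeFactors hp₀)
  have hblock₀ : (2 : ℝ) ≤ ((p₀ ^ N.factorization p₀ : ℕ) : ℝ) := by
    exact_mod_cast le_trans hp₀P.two_le (Nat.le_self_pow hv₀.ne' p₀)
  have hc4 : (2 : ℝ) < (c : ℝ) ^ (1 / 4 : ℝ) := hblock₀.trans_lt (hflat p₀ hp₀)
  have hc0 : (0 : ℝ) < c := by exact_mod_cast hc
  have hc1 : (1 : ℝ) < c := by
    by_contra hle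
    have : (c : ℝ) ^ (1 / 4 : ℝ) ≤ 1 := Real.rpow_le_one hc0.le (not_lt.mp hle) (by norm_num)
    linarith
  -- upper bound: `N < (c^{1/4})^ω = c^{ω/4}`
  have hupper : (N : ℝ) < (c : ℝ) ^ ((N.primeFactors.card : ℝ) / 4) := by
    have hlt : ∏ p ∈ N.primeFactors, ((p ^ N.factorization p : ℕ) : ℝ) <
        ∏ _p ∈ N.primeFactors, (c : ℝ) ^ (1 / 4 : ℝ) :=
      Finset.prod_lt_prod_of_nonempty
        (fun p hp => by
          have := (Nat.prime_of_mem_primeFactors hp).pos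
          positivity)
        hflat ⟨p₀, hp₀⟩
    rw [Finset.prod_const, ← Nat.cast_prod, hprod] at hlt
    convert hlt using 1
    rw [← Real.rpow_natCast, ← Real.rpow_mul hc0.le]
    ring_nf
  -- lower bound: `N ≥ c (c - 1) ≥ c^{7/4}` (as `c − 1 ≥ c/2 ≥ c^{3/4}` from `c^{1/4} > 2`)
  have hlower : (c : ℝ) ^ ((7 : ℝ) / 4) ≤ N := by
    have h1 : ((c * (c - 1) : ℕ) : ℝ) ≤ N := by exact_mod_cast mul_pred_le_abc h'
    have hc16 : (16 : ℝ) < c := by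
      have h := Real.rpow_lt_rpow (by norm_num) hc4 (show (0 : ℝ) < 4 by norm_num)
      rw [← Real.rpow_mul hc0.le] at h
      norm_num at h
      exact_mod_cast h
    have hc1' : (1 : ℝ) ≤ c := hc1.le
    have hpred : ((c * (c - 1) : ℕ) : ℝ) = (c : ℝ) * ((c : ℝ) - 1) := by
      have : 1 ≤ c := hc
      push_cast [Nat.cast_sub this]
      ring
    -- `c^{3/4} ≤ c/2 ≤ c - 1`
    have h34 : (c : ℝ) ^ ((3 : ℝ) / 4) ≤ (c : ℝ) - 1 := by
      have hsplit : (c : ℝ) = (c : ℝ) ^ ((3 : ℝ) / 4) * (c : ℝ) ^ (1 / 4 : ℝ) := by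
        rw [← Real.rpow_add hc0]; norm_num
      have hq : 0 ≤ (c : ℝ) ^ ((3 : ℝ) / 4) := by positivity
      nlinarith [hsplit, hc4, hq]
    calc (c : ℝ) ^ ((7 : ℝ) / 4) = (c : ℝ) * (c : ℝ) ^ ((3 : ℝ) / 4) := by
          rw [show (7 : ℝ) / 4 = 1 + 3 / 4 by norm_num, Real.rpow_add hc0, Real.rpow_one]
      _ ≤ (c : ℝ) * ((c : ℝ) - 1) := mul_le_mul_of_nonneg_left h34 hc0.le
      _ = ((c * (c - 1) : ℕ) : ℝ) := hpred.symm
      _ ≤ N := h1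
  -- compare exponents
  have hlt : (c : ℝ) ^ ((7 : ℝ) / 4) < (c : ℝ) ^ ((N.primeFactors.card : ℝ) / 4) :=
    hlower.trans_lt hupper
  have := (Real.rpow_lt_rpow_left_iff hc1).mp hlt
  have h7 : (7 : ℝ) < N.primeFactors.card := by linarith
  exact_mod_cast (show (7 : ℝ) < N.primeFactors.card from h7)

end Summit.ABC.ABC.Theorems.UniformSadicTowerFour.FlatFace
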